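import Summits.Ventures.PercRepro.RankLevelSetHCore

/-!
# PercRepro — planes of a simple matroid: the rank-3 flats (p2, gen 5)

The plane analogue of `RankLevelSetHCore.lean`'s line machinery, for mine-2's Theorem O (`MINE2-RLS.md` §16,
`(p, q) = (5, 3)`): `planes M` = the rank-3 flats of the finite ground set as finsets; a rank-3 subset of a plane has
the plane as its closure; two planes sharing a rank-3 subset coincide; the intersection of two distinct planes has
rank at most `2` (so it lies on a line); adding a point off a plane to a rank-3 subset gives rank `4`.
Imports Mathlib and `RankLevelSetHCore` only.
-/

namespace PercRepro

namespace ThmH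

variable {α : Type*} {M : Matroid α}

/-- A subset of a flat with the same rank has the flat as its closure. -/
theorem closure_eq_of_subset_flat {F B : Set α} (hF : M.IsFlat F) (hB : B ⊆ F) (hBfin : B.Finite)
    (hr : M.eRk F ≤ M.eRk B) : M.closure B = F := by
  have hFE : F ⊆ M.E := hF.subset_ground
  obtain ⟨I, hI⟩ := M.exists_isBasis B (hB.trans hFE)
  have hIr : M.eRk F ≤ M.eRk I := by
    rw [hI.indep.eRk_eq_encard, hI.encard_eq_eRk]; exact hr
  have hIF : M.IsBasis I F :=
    hI.indep.isBasis_of_eRk_ge (hBfin.subset hI.subset) (hI.subset.trans hB) hIr hFE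
  rw [← hI.closure_eq_closure, hIF.closure_eq_closure, hF.closure]

variable [M.Finite]

/-- The rank of a finset is a natural number bounded by its size (plane-file copy of `ThmN.exists_nat_eRk`). -/
theorem eRk_eq_nat (M : Matroid α) [M.Finite] (X : Finset α) :
    ∃ k : ℕ, M.eRk (X : Set α) = k ∧ k ≤ X.card := by
  have h := M.eRk_le_encard (X : Set α)
  rw [Set.encard_coe_eq_coe_finsetCard] at h
  have hne : M.eRk (X : Set α) ≠ ⊤ := ne_top_of_le_ne_top (ENat.coe_ne_top _) h
  obtain ⟨k, hk⟩ := ENat.ne_top_iff_exists.1 hne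
  refine ⟨k, hk.symm, ?_⟩
  rw [← hk] at h
  exact_mod_cast h

open scoped Classical in
/-- The planes of `M`: the rank-3 flats, as finsets of the ground set. -/
noncomputable def planes (M : Matroid α) [M.Finite] : Finset (Finset α) :=
  (gr M).powerset.filter (fun G => M.IsFlat (G : Set α) ∧ M.eRk (G : Set α) = 3)

open scoped Classical in
/-- Membership in `planes`. -/
theorem mem_planes {G : Finset α} :
    G ∈ planes M ↔ G ⊆ gr M ∧ M.IsFlat (G : Set α) ∧ M.eRk (G : Set α) = 3 := by
  simp [planes]

/-- A rank-3 subset of a plane has the plane as its closure. -/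
theorem closure_eq_of_subset_plane {G B : Finset α} (hG : G ∈ planes M) (hB : B ⊆ G)
    (hr : M.eRk (B : Set α) = 3) : M.closure (B : Set α) = (G : Set α) := by
  obtain ⟨-, hGflat, hGr⟩ := mem_planes.1 hG
  exact closure_eq_of_subset_flat hGflat (Finset.coe_subset.2 hB) (B.finite_toSet) (by rw [hGr, hr])

/-- Two planes sharing a rank-3 subset coincide. -/
theorem planes_eq_of_subset {G G' B : Finset α} (hG : G ∈ planes M) (hG' : G' ∈ planes M) (hB : B ⊆ G)
    (hB' : B ⊆ G') (hr : M.eRk (B : Set α) = 3) : G = G' :=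
  Finset.coe_injective ((closure_eq_of_subset_plane hG hB hr).symm.trans (closure_eq_of_subset_plane hG' hB' hr))

/-- The intersection of two distinct planes has rank at most `2`. -/
theorem eRk_inter_le_two_of_ne [DecidableEq α] {G G' : Finset α} (hG : G ∈ planes M) (hG' : G' ∈ planes M) (hne : G ≠ G') :
    M.eRk ((G ∩ G' : Finset α) : Set α) ≤ 2 := by
  by_contra h
  push Not at h
  have h3 : M.eRk ((G ∩ G' : Finset α) : Set α) = 3 := by
    apply le_antisymm
    · rw [← (mem_planes.1 hG).2.2]
      exact M.eRk_mono (Finset.coe_subset.2 Finset.inter_subset_left)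
    · exact Order.add_one_le_of_lt h
  exact hne (planes_eq_of_subset hG hG' Finset.inter_subset_left Finset.inter_subset_right h3)

/-- Adding a point off a plane to a rank-3 subset gives rank `4`. -/
theorem eRk_insert_eq_four [DecidableEq α] {G B : Finset α} (hG : G ∈ planes M) (hB : B ⊆ G) (hr : M.eRk (B : Set α) = 3)
    {x : α} (hx : x ∈ gr M) (hxG : x ∉ G) : M.eRk ((insert x B : Finset α) : Set α) = 4 := by
  have hcl := closure_eq_of_subset_plane hG hB hr
  have hxE : x ∈ M.E := by rw [← coe_gr M]; exact_mod_cast hx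
  have hx' : x ∈ M.E \ M.closure (B : Set α) := by
    rw [hcl]; exact ⟨hxE, by exact_mod_cast hxG⟩
  rw [Finset.coe_insert, Matroid.eRk_insert_eq_add_one hx', hr]
  rfl

/-- The closure of a rank-3 subset of the ground set is a plane containing it. -/
theorem clF_mem_planes {B : Finset α} (hB : B ⊆ gr M) (hr : M.eRk (B : Set α) = 3) :
    clF M B ∈ planes M ∧ B ⊆ clF M B := by
  have hBE : (B : Set α) ⊆ M.E := by rw [← coe_gr M]; exact_mod_cast hB
  refine ⟨?_, ?_⟩
  · rw [mem_planes, coe_clF]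
    refine ⟨?_, M.isFlat_closure _, by rw [M.eRk_closure_eq, hr]⟩
    rw [← Finset.coe_subset, coe_clF, coe_gr]
    exact M.closure_subset_ground _
  · rw [← Finset.coe_subset, coe_clF]
    exact M.subset_closure _ hBE

end ThmH

end PercRepro
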